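import Mathlib.CategoryTheory.Groupoid
import Mathlib.CategoryTheory.Core
import Mathlib.CategoryTheory.Pi.Basic
import Mathlib.CategoryTheory.ObjectProperty.FullSubcategory
import Mathlib.GroupTheory.Congruence.Defs
import Mathlib.GroupTheory.OrderOfElement
import Mathlib.Algebra.Group.Submonoid.Operations
import HarnessLib

/-!
# Prime-strip categories (generic pattern of [IUTchI] Def 5.2 / [IUTchII] Def 4.9 (vii) / [IUTchIII] Def 2.4 (ii)) and the quotient of a monoid by its torsion ([IUTchIII] Def 2.4 (i))

Mochizuki, *Inter-universal Teichmüller Theory III*, kurims manuscript (May 2020), §2, Definition 2.4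
(i)–(ii), pp. 87–88 [cite: Mochizuki2012, III Def 2.4 (i)(ii) pp.87–88] (D-0012 claim key, status
disputed; this file is definitional and generic, and takes no side).

Printed text, Def 2.4 (ii) p.88: "we define an `F^{⊢⊥}`-prime-strip to be a collection of data
`*F^{⊢⊥} = {*F^{⊢⊥}_v}_{v∈V̲}` that satisfies the following conditions: (a) if `v ∈ V̲^{non}`, then `*F^{⊢⊥}_v` is a
Frobenioid that is isomorphic to `‡F^{⊢⊥}_v` [cf. (i)]; (b) if `v ∈ V̲^{arc}`, then `*F^{⊢⊥}_v` consists of a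
Frobenioid and an object of `TM^⊢` … such that `*F^{⊢⊥}_v` is isomorphic to `‡F^{⊢⊥}_v`. … A morphism of
`F^{⊢⊥}`- (respectively, `F^{⊢▶}`-) prime-strips is defined to be a collection of isomorphisms, indexed by
`V̲`, between the various constituent objects of the prime-strips [cf. [IUTchI], Definition 5.2, (iii)]."
The same sentence pattern defines `F`-, `F^⊢`-prime-strips [IUTchI, Def 5.2 (i)–(iii) p.134] and
`F^{⊢×}`/`F^{⊢×μ}`/`F^{⊢▶×μ}`-prime-strips [IUTchII, Def 4.9 (vii) p.158]: at each `v` an object of some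
ambient category of local data ISOMORPHIC TO A FIXED MODEL, morphisms = `V̲`-indexed families of
isomorphisms. Def 2.4 (i) p.88: "quotient monoids "`O^⊥(−) ↠ O^▶(−)`" [i.e., by forming the quotient of
"`O^⊥(−)`" by its torsion subgroup]"; at good `w` "a submonoid "`O^⊥(−) ⊆ O^▷(−)`" whose subgroup of units
is trivial …; in this case, we set `O^▶(−) := O^⊥(−)`."

This file provides, once, the two GENERIC constructions:
* `StripCat G m`: for a family of ambient categories `G v` (`v : V`) and model objects `m v`, the
  category whose objects are families `X : Π v, G v` with each `X v` isomorphic to `m v` and whose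
  morphisms are `V̲`-indexed families of isomorphisms (the core of the full subcategory of the product
  category). PROVED: it is a groupoid (`IsGroupoid`) and CONNECTED (`StripCat.iso_nonempty`: any two
  prime-strips are isomorphic) — the fact the interface `StripFrame.iso_nonempty_*` of
  `PrimeStripFrame.lean` records.
* `torsionCon M` / `ModTorsion M`: the quotient of a commutative monoid by (the congruence generated
  by multiplication by) its torsion units, `O^▶ := O^⊥/O^μ`; PROVED: if the only torsion unit is `1`
  (good `w`: "subgroup of units is trivial") the quotient map is bijective (`O^▶ = O^⊥`).
Owners of the concrete local categories (Frobenioids, `TM^⊢`): abc-iut-L1 / L5-t2; TODO-merge.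
-/

namespace Literature.IUT.LogThetaLattice

open CategoryTheory

universe v u w

/-! ### Prime-strip categories -/

section StripCat

variable {V : Type w} (G : V → Type u) [∀ v, Category.{v} (G v)] (m : ∀ v, G v)

/-- The defining property of a prime-strip: "`*F_v` is [an object of the ambient category at `v`] that is
isomorphic to" the model `m v`, for every `v ∈ V̲`. [cite: Mochizuki2012, III Def 2.4 (ii) p.88] -/
def IsStrip : ObjectProperty (∀ v, G v) := fun X => ∀ v, Nonempty (X v ≅ m v)

/-- The ambient category of `V̲`-indexed collections with ARBITRARY families of morphisms (product
category), restricted to collections componentwise isomorphic to the model.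
[cite: Mochizuki2012, III Def 2.4 (ii) p.88] -/
abbrev StripAmbient : Type (max w u) := (IsStrip G m).FullSubcategory

/-- **The category of prime-strips** modelled on `m`: objects = collections `{*F_v}_{v∈V̲}` with `*F_v ≅ m v`;
morphisms = "collection[s] of isomorphisms, indexed by `V̲`, between the various constituent objects" —
i.e. the CORE (isomorphisms only) of `StripAmbient`. [cite: Mochizuki2012, III Def 2.4 (ii) p.88] -/
def StripCat : Type (max w u) := Core (StripAmbient G m)

/-- `StripCat` is a groupoid (morphisms are families of isomorphisms). [cite: Mochizuki2012, III Def 2.4 (ii) p.88] -/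
noncomputable instance StripCat.groupoid : Groupoid (StripCat G m) :=
  inferInstanceAs (Groupoid (Core (StripAmbient G m)))

variable {G m}

/-- The underlying collection `{*F_v}_v` of a prime-strip. [cite: Mochizuki2012, III Def 2.4 (ii) p.88] -/
def StripCat.val (X : StripCat G m) : ∀ v, G v := X.of.obj

/-- Each component of a prime-strip is isomorphic to the model. [cite: Mochizuki2012, III Def 2.4 (ii) p.88] -/
theorem StripCat.isStrip (X : StripCat G m) (v : V) : Nonempty (X.val v ≅ m v) := X.of.property v

/-- The model collection itself is a prime-strip. [cite: Mochizuki2012, III Def 2.4 (ii) p.88] -/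
def StripCat.model : StripCat G m := ⟨⟨m, fun _ => ⟨Iso.refl _⟩⟩⟩

/-- Build a prime-strip from a collection and componentwise isomorphisms to the model.
[cite: Mochizuki2012, III Def 2.4 (ii) p.88] -/
def StripCat.mk' (X : ∀ v, G v) (h : ∀ v, Nonempty (X v ≅ m v)) : StripCat G m := ⟨⟨X, h⟩⟩

/-- The `v`-component of a morphism of prime-strips is an isomorphism `X_v ⥲ Y_v` ("collection of
isomorphisms indexed by `V̲`"). [cite: Mochizuki2012, III Def 2.4 (ii) p.88] -/
def StripCat.component {X Y : StripCat G m} (f : X ⟶ Y) (v : V) : X.val v ≅ Y.val v where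
  hom := f.iso.hom.hom v
  inv := f.iso.inv.hom v
  hom_inv_id := congrArg (fun g : X.of ⟶ X.of => g.hom v) f.iso.hom_inv_id
  inv_hom_id := congrArg (fun g : Y.of ⟶ Y.of => g.hom v) f.iso.inv_hom_id

/-- Conversely a `V̲`-indexed family of isomorphisms IS a morphism of prime-strips.
[cite: Mochizuki2012, III Def 2.4 (ii) p.88] -/
def StripCat.ofComponents {X Y : StripCat G m} (e : ∀ v, X.val v ≅ Y.val v) : X ⟶ Y where
  iso :=
    { hom := ⟨fun v => (e v).hom⟩
      inv := ⟨fun v => (e v).inv⟩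
      hom_inv_id := by ext; simp [StripCat.val]
      inv_hom_id := by ext; simp [StripCat.val] }

/-- **Connectedness: any two prime-strips (of the same kind) are isomorphic** — both are componentwise
isomorphic to the model. This is what `StripFrame.iso_nonempty_*` records.
[cite: Mochizuki2012, III Def 2.4 (ii) p.88] -/
theorem StripCat.iso_nonempty (X Y : StripCat G m) : Nonempty (X ≅ Y) := by
  refine ⟨Groupoid.isoEquivHom _ _ |>.symm (StripCat.ofComponents fun v => ?_)⟩
  exact (X.isStrip v).some ≪≫ ((Y.isStrip v).some).symm

end StripCat

/-! ### Def 2.4 (i): the quotient of a commutative monoid by its torsion, `O^▶ := O^⊥ / O^μ` -/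

section Torsion

variable (M : Type u) [CommMonoid M]

/-- The relation "`y = ζ · x` for a torsion unit `ζ`" on a commutative monoid (`O^μ` = the torsion subgroup
of the units acting by multiplication). [cite: Mochizuki2012, III Def 2.4 (i) p.88] -/
def TorsionRel (x y : M) : Prop := ∃ u : Mˣ, IsOfFinOrder u ∧ y = (u : M) * x

/-- `TorsionRel` is a congruence relation. [cite: Mochizuki2012, III Def 2.4 (i) p.88] -/
def torsionCon : Con M where
  r := TorsionRel M
  iseqv :=
    { refl := fun x => ⟨1, IsOfFinOrder.one, by simp⟩
      symm := by
        rintro x y ⟨u, hu, rfl⟩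
        exact ⟨u⁻¹, hu.inv, by simp⟩
      trans := by
        rintro x y z ⟨u, hu, rfl⟩ ⟨u', hu', rfl⟩
        exact ⟨u' * u, (Commute.all u' u).isOfFinOrder_mul hu' hu, by simp [mul_assoc]⟩ }
  mul' := by
    rintro w x y z ⟨u, hu, rfl⟩ ⟨u', hu', rfl⟩
    refine ⟨u * u', (Commute.all u u').isOfFinOrder_mul hu hu', ?_⟩
    simp only [Units.val_mul]
    rw [mul_mul_mul_comm]

/-- **`O^▶ := O^⊥ / O^μ`**: the quotient of the commutative monoid `M` (= `O^⊥(−)`) "by its torsion subgroup".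
[cite: Mochizuki2012, III Def 2.4 (i) p.88] -/
abbrev ModTorsion : Type u := (torsionCon M).Quotient

/-- The quotient map `O^⊥ ↠ O^▶`. [cite: Mochizuki2012, III Def 2.4 (i) p.88] -/
def ModTorsion.mk : M →* ModTorsion M := (torsionCon M).mk'

/-- The quotient map is surjective ("`↠`"). [cite: Mochizuki2012, III Def 2.4 (i) p.88] -/
theorem ModTorsion.mk_surjective : Function.Surjective (ModTorsion.mk M) := Quotient.mk''_surjective

/-- Two elements have the same image in `O^▶` iff they differ by a torsion unit.
[cite: Mochizuki2012, III Def 2.4 (i) p.88] -/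
theorem ModTorsion.mk_eq_mk_iff (x y : M) :
    ModTorsion.mk M x = ModTorsion.mk M y ↔ ∃ u : Mˣ, IsOfFinOrder u ∧ y = (u : M) * x :=
  (torsionCon M).eq

/-- A torsion unit maps to `1` in `O^▶`. [cite: Mochizuki2012, III Def 2.4 (i) p.88] -/
theorem ModTorsion.mk_torsion_unit (u : Mˣ) (hu : IsOfFinOrder u) : ModTorsion.mk M (u : M) = 1 := by
  rw [← map_one (ModTorsion.mk M), ModTorsion.mk_eq_mk_iff]
  exact ⟨u⁻¹, hu.inv, by simp⟩

/-- **Good places**: if the only torsion unit is `1` ("a submonoid … whose subgroup of units is trivial"),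
the quotient map `O^⊥ → O^▶` is bijective — "in this case, we set `O^▶(−) := O^⊥(−)`".
[cite: Mochizuki2012, III Def 2.4 (i) p.88] -/
theorem ModTorsion.mk_bijective_of_torsionfree (h : ∀ u : Mˣ, IsOfFinOrder u → u = 1) :
    Function.Bijective (ModTorsion.mk M) := by
  refine ⟨fun x y hxy => ?_, ModTorsion.mk_surjective M⟩
  obtain ⟨u, hu, rfl⟩ := (ModTorsion.mk_eq_mk_iff M x y).mp hxy
  rw [h u hu, Units.val_one, one_mul]

/-- In particular if `M` has trivial unit group the quotient map is bijective.
[cite: Mochizuki2012, III Def 2.4 (i) p.88] -/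
theorem ModTorsion.mk_bijective_of_units_trivial [Subsingleton Mˣ] :
    Function.Bijective (ModTorsion.mk M) :=
  ModTorsion.mk_bijective_of_torsionfree M fun u _ => Subsingleton.elim u 1

end Torsion

end Literature.IUT.LogThetaLattice
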